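import Summits.Ventures.HodgeRepro2.T6N41PlaceMain

/-!
# T6N41PlaceToy — non-vacuity witnesses for the placement layer (README §10.5(ii)(c)/(d))

A toy N4.1 datum with ONE place NOT in `S` (`ι = Unit`, `S = ∅`), one prime of `E` above it with `N(𝔓) = 2`, the
doubling factor `L_v(s) = (1 − 2^{−s})⁻¹ (1 − 2^{−s})⁻¹` and both Hecke factors `(1 − 2^{−s})⁻¹` (all Satake
parameters and character values `1`), and a placement datum over it whose `RepGL 𝔓` is the type of Satake
pairs itself (`ℂˣ × ℂˣ`, `ps = Prod.mk`).  On it the two displays of `T6N41PlaceHyp` and the Satake identity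
hold SIMULTANEOUSLY, the place is unramified (so `hunr` is NOT vacuous, unlike on `N41Toy.toyDatum` where
`S = univ`), and `N41_placement_of_satake` produces the identity `L_v = g₁ g₂` on it: (c) `PlacementDatum D` is
instantiable, (d) the hypotheses of the placement theorem are jointly satisfiable; no display is closed by
`trivial` / `simp` / `decide` / `exact ⟨⟩` on a general datum — each proof uses the toy's specific data.

§8(d): uses an L-value-free non-vanishing device: NO.
-/

namespace Summit.Ventures.HodgeRepro2.T6
namespace N41PlaceToy

/-- Bump's factor at `q = 2` for the parameter `1`: `(1 − 2^{−s})⁻¹`. -/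
noncomputable def f (s : ℂ) : ℂ := (1 - (1 : ℂ) * (2 : ℂ) ^ (-s))⁻¹

/-- The toy N4.1 datum: one place, NOT in `S`; `L_v = f · f`, `g₁ = g₂ = f`, everything else as in `N41Toy`. -/
noncomputable def toyDatum : DoublingLDatum Unit where
  S := ∅
  Lv := fun _ s => f s * f s
  L := fun _ => 1
  thetaNonzero := fun _ => True
  L₁ := fun _ => 1
  L₂ := fun _ => 1
  g₁ := fun _ => f
  g₂ := fun _ => f
  triv₁ := False
  triv₂ := False

/-- The toy placement datum: one prime (`κ = Unit`) of norm `2`; `RepGL = ℂˣ × ℂˣ` (a representation is its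
Satake pair), `ps = Prod.mk`, `LGL` = Bump's (5.22) on the pair; `BCχ = (1, 1)`; `η₁ = η₂ = 1`. -/
noncomputable def toyPl : PlacementDatum toyDatum where
  κ := Unit
  b := fun _ => ()
  fin := fun _ => Set.toFinite _
  N := fun _ => 2
  one_lt_N := fun _ => by norm_num
  RepGL := fun _ => ℂˣ × ℂˣ
  ps := fun _ a b => (a, b)
  LGL := fun _ p s => (1 - (p.1 : ℂ) * (2 : ℂ) ^ (-s))⁻¹ * (1 - (p.2 : ℂ) * (2 : ℂ) ^ (-s))⁻¹
  BCχ := fun _ => (1, 1)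
  LGLv := fun _ s => f s * f s
  LGLv_eq := fun _ => by
    funext s
    simp [f]
  α := fun _ => 1
  β := fun _ => 1
  BCχ_ps := fun _ _ => rfl
  η₁ := fun _ => 1
  η₂ := fun _ => 1
  g₁_eq := fun _ _ => by
    funext s
    simp [toyDatum, f]
  g₂_eq := fun _ _ => by
    funext s
    simp [toyDatum, f]

/-- Lapid–Rallis §7 holds on the toy: `L_v = f · f = LGLv`. -/
theorem toy_LR7 : Hyp.LapidRallis2005_Sec7_Unramified toyDatum toyPl := fun _ _ => rfl

/-- Bump (5.22) holds on the toy: `LGL (ps α₁ α₂)` is the product of the two factors by construction. -/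
theorem toy_Bump : Hyp.Bump1997_5_22 toyPl := fun _ _ _ => rfl

/-- The Satake identity holds on the toy (`α = η₁ = 1`, `β = η₂ = 1`). -/
theorem toy_satake : toyPl.Satake := fun _ _ => Or.inl ⟨rfl, rfl⟩

/-- **(d) for the placement layer:** on the toy the hypotheses of `N41_placement_of_satake` hold jointly and
its conclusion — the unramified identity at the toy's (unramified) place — is obtained by applying the theorem. -/
theorem toy_placement : ∀ v ∉ toyDatum.S, ∀ s : ℂ, toyDatum.Lv v s = toyDatum.g₁ v s * toyDatum.g₂ v s :=
  N41Place.N41_placement_of_satake toyDatum toyPl toy_LR7 toy_Bump toy_satake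

/-- The toy's place is unramified: the identity of `toy_placement` is NOT vacuous (`() ∉ ∅`). -/
theorem toy_placement_at_unit (s : ℂ) : toyDatum.Lv () s = toyDatum.g₁ () s * toyDatum.g₂ () s :=
  toy_placement () (Finset.notMem_empty _) s

/-- (c) the carrier `PlacementDatum D` is instantiable over EVERY datum `D` whose `S` is everything (one prime
per place, all parameters `1`; `g₁_eq` / `g₂_eq` / `BCχ_ps` then constrain nothing — the placement datum adds
no information to such a `D`). -/
theorem nonempty_placementDatum_of_S_univ {ι : Type} [Fintype ι] (D : DoublingLDatum ι)
    (hS : D.S = Finset.univ) : Nonempty (PlacementDatum D) :=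
  ⟨{ κ := ι, b := id, fin := fun _ => Set.toFinite _, N := fun _ => 2, one_lt_N := fun _ => by norm_num,
     RepGL := fun _ => Unit, ps := fun _ _ _ => (), LGL := fun _ _ _ => 1, BCχ := fun _ => (),
     LGLv := fun _ _ => 1,
     LGLv_eq := fun v => by
       funext s
       simp,
     α := fun _ => 1, β := fun _ => 1, BCχ_ps := fun _ _ => rfl, η₁ := fun _ => 1, η₂ := fun _ => 1,
     g₁_eq := fun v hv => (hv (hS ▸ Finset.mem_univ v)).elim,
     g₂_eq := fun v hv => (hv (hS ▸ Finset.mem_univ v)).elim }⟩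

end N41PlaceToy
end Summit.Ventures.HodgeRepro2.T6
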